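import Summits.QuantumAdvantage.QuantumAdvantage.Theorems.SosSandwichQueryHomogeneousRung
import HarnessLib

/-!
# The homogeneous rung on `Q_T` — packaged forms (AA_Q shape; the route's rung body with `C = 4`)

Support theorem for route `SosSandwich`, crux `PseudoBoundedAA` (stmt-QuantumAdvantage-15237); Part 4 of the package
`SosSandwichQueryTopLevel{Step,Weight}` / `SosSandwichQueryHomogeneousRung`.  Two thin repackagings of
`queryHomogeneousRung` (Escudero Gutiérrez Cor 1.7 in the tree's `QQueryAlg` model) in the shapes the planner's items use:

* `aaQuery_homogeneous` — the hypothesis `AA_Q` of `QTRestrict.quantumQuerySimulable_of_aaQuery` (Aaronson–Ambainis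
  influence bound for quantum acceptance probabilities) HOLDS on top-homogeneous acceptance polynomials with
  `(c, C) = (2, 4)`;
* `homogeneousPBAA_body_on_QT` — verbatim the body of the route decl `Theses.SosSandwich.HomogeneousPBAA` (refuted on
  `K_T`), inline `let ev … let avg …` vocabulary, with the SOS antecedent replaced by "`p` is the acceptance
  polynomial of a `T`-query algorithm", constant `C = 4`.

Sources: EscuderoGutierrez2023 (arXiv:2304.06713) Cor 1.7; AaronsonAmbainis2014 Conj. 6 / Thm 7.
-/

noncomputable section

set_option linter.dupNamespace false

namespace Summit.QuantumAdvantage.QuantumAdvantage.Theorems.SosSandwich.QueryTopLevel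

open Matrix Finset Literature.Computability.Cryptography Literature.Computability.QuantumComplexity

variable {N : ℕ}

/-! ## Packaged forms: AA_Q (homogeneous case) and the route's rung body on `Q_T` -/

section Packaged

/-- **AA_Q, homogeneous case, with constants `(c, C) = (2, 4)`.**  In the exact shape of the hypothesis `AA_Q` of
`Theorems.SosSandwich.QTRestrict.quantumQuerySimulable_of_aaQuery` (the Aaronson–Ambainis influence bound for
acceptance probabilities of quantum query algorithms), restricted to TOP-HOMOGENEOUS acceptance polynomials:
`Var ≥ ε > 0 ⟹ ∃ i, 4 (ε/T)² ≤ Inf_i` (indeed `4 (ε/T)² ≤ 4 ε² ≤ 4 Var² ≤ Inf_i`). [cite: EscuderoGutierrez2023, Cor 1.7] -/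
theorem aaQuery_homogeneous :
    ∃ (c : ℕ) (C : ℝ), 0 < C ∧ ∀ (N : ℕ) (Q : QQueryAlg N) (p : MvPolynomial (Fin N) ℝ) (ε : ℝ),
      1 ≤ Q.queries → (∀ x, evalBool p x = Q.acceptProb x) →
      (∀ x : Fin N → Bool, ∑ i : Fin N, (evalBool p x - evalBool p (Function.update x i (!x i))) =
        4 * (Q.queries : ℝ) * (evalBool p x - boolAvg (evalBool p))) →
      0 < ε → ε ≤ boolVariance p → ∃ i : Fin N, C * (ε / Q.queries) ^ c ≤ influence i p := by
  refine ⟨2, 4, by norm_num, fun N Q p ε hT hp hhom hε hεv => ?_⟩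
  obtain ⟨i, hi⟩ := queryHomogeneousRung Q hT p hp hhom
  refine ⟨i, le_trans ?_ hi⟩
  have hT1 : (1 : ℝ) ≤ Q.queries := by exact_mod_cast hT
  have h1 : ε / Q.queries ≤ ε := div_le_self hε.le hT1
  have h2 : 0 ≤ ε / Q.queries := div_nonneg hε.le (by positivity)
  have h3 : (ε / Q.queries) ^ 2 ≤ boolVariance p ^ 2 := pow_le_pow_left₀ h2 (h1.trans hεv) 2
  linarith

/-- **The route's degree-free rung body, ON `Q_T`.**  Verbatim the body of the (refuted-on-`K_T`) route decl
`Theses.SosSandwich.HomogeneousPBAA` — inline cube vocabulary `let ev … let avg …` — with its SOS-sandwich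
antecedent replaced by "`p` takes the values of the acceptance probability of some `T`-query algorithm", and the
explicit constant `C = 4`.  (The inline `ev`/`avg` are definitionally `evalBool`/`boolAvg`.) [cite: EscuderoGutierrez2023, Cor 1.7] -/
theorem homogeneousPBAA_body_on_QT :
    ∃ C : ℝ, 0 < C ∧ ∀ (N T : ℕ) (p : MvPolynomial (Fin N) ℝ),
      let ev : MvPolynomial (Fin N) ℝ → (Fin N → Bool) → ℝ :=
        fun f x => MvPolynomial.eval (fun k => if x k then (1 : ℝ) else 0) f
      let avg : ((Fin N → Bool) → ℝ) → ℝ := fun g => (∑ x : Fin N → Bool, g x) / (2 : ℝ) ^ N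
      1 ≤ T → (∃ A : QQueryAlg N, A.queries = T ∧ ∀ x, ev p x = A.acceptProb x) →
      (∀ x : Fin N → Bool, ∑ i : Fin N, (ev p x - ev p (Function.update x i (!x i))) =
        4 * (T : ℝ) * (ev p x - avg (ev p))) →
      0 < (avg fun x => (ev p x - avg (ev p)) ^ 2) →
      ∃ i : Fin N, C * (avg fun x => (ev p x - avg (ev p)) ^ 2) ^ 2 ≤
        (avg fun x => (ev p x - ev p (Function.update x i (!x i))) ^ 2) := by
  refine ⟨4, by norm_num, ?_⟩
  intro N T p ev avg hT hA hhom _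
  obtain ⟨A, hAT, hp⟩ := hA
  subst hAT
  -- the inline vocabulary is definitionally the tree's
  change ∃ i : Fin N, 4 * boolVariance p ^ 2 ≤ influence i p
  exact queryHomogeneousRung A hT p hp hhom

end Packaged

end Summit.QuantumAdvantage.QuantumAdvantage.Theorems.SosSandwich.QueryTopLevel

end
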